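import Summits.QuantumAdvantage.QuantumAdvantage.Theorems.CouplingDialIndex

/-!
# CouplingDial (part G, padded unipotent planting) — `N_{⌊n^{1/(a+1)}⌋}` THEOREM for every `a` (`cvalue_dsum`, `pinst`, `nilRung_of_schedule`, `nilRung_sqrt`, `nilRung_root`)

Tree twin of node «CouplingDial» rev 5 §13 (cut verbatim).  Coupled Forrelation values MULTIPLY over direct sums
(`csum_dsum`, `cvalue_dsum`); the free exact block `idT t = (IP_t, IP_t, 𝟙_{2t})` has value `1` (`cvalue_idT`); the padded hidden-coupling
instance `pinst w t = hinst w ⊞ idT t` keeps the `MOD₃` label (`cvalue_pinst`), the unipotency index `m + 1` (`unipotent_blockDiag`,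
`unipotent_pinst`) and a code that is a literal projection of `w` (`isProj_encode_pinst`); hence the padded schedule theorem
`nilRung_of_schedule` and ★ `nilRung_sqrt : NilRung Nat.sqrt`, ★ `nilRung_root : ∀ a, NilRung (n ↦ Nat.findGreatest (r ↦ r^(a+1) ≤ n) n)`,
`nilRung_of_root_le`, `dial_summary_rev5` (imports F for `constNilRung_iff`).
-/

set_option linter.dupNamespace false

noncomputable section

namespace Summit.QuantumAdvantage.QuantumAdvantage.Theorems.CouplingDial

open Finset
open Literature.Computability.Complexity
open Literature.Computability.QuantumComplexity
open Literature.Computability.MetaComplexity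
open _root_.Computability (encodeNat)
open Summit.QuantumAdvantage.QuantumAdvantage.Theorems.HintDial
open Summit.QuantumAdvantage.QuantumAdvantage.Theorems.HintDial.Automaton
open Summit.QuantumAdvantage.QuantumAdvantage.Theorems.GapDial.Automaton (blockDiag blockDiag_left blockDiag_right
  mv_blockDiag bd_zero_left EE bxor_append)
open Summit.QuantumAdvantage.QuantumAdvantage.Theorems.FlatDial (clen length_encode_eq_clen clen_injective clen_lt_clen le_clen)
open Summit.QuantumAdvantage.QuantumAdvantage.Theses.AnfPresentation (RungANonuniform RungA LiftA AnfEquiv NearExactIsExact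
  SignedExactSliceIsLift)
open CubicForm (bit)
open DerivativeWalsh (W)
open BuzetChailloux (bxor zeroVec)

/-! ## §13 ★★★ THE THEOREM END OF THE UNIPOTENCY DIAL REACHES EVERY POLYNOMIAL ROOT: `N_{⌊n^{1/(a+1)}⌋}` HOLDS (padded planting)

The hidden-coupling instance `hinst w` (§9: arity `6m+6`, coupling `Q_w ⊕ Q_wᵀ` unipotent of index `m+1`, value `-(-1)^{s_w(b₀)}`)
padded by the FREE EXACT BLOCK `idT t = (IP_t, IP_t, 𝟙_{2t})` (value `1`, index `1`): `pinst w t` has arity `n = (6m+6) + 2t`, a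
coupling unipotent of index `m + 1` (`unipotent_blockDiag`), the SAME `MOD₃` label — coupled values MULTIPLY over direct sums
(`csum_dsum`, `cvalue_dsum`, `cvalue_idT`, `cvalue_pinst`) — and a code that is still a literal projection of `w` (`isProj_encode_pinst`).
With a polynomial padding schedule `t(m)` the index `m+1` is pushed below any polynomial root of the arity: `nilRung_of_schedule`,
`nilRung_sqrt : N_{√n}`, `nilRung_root : ∀ a, N_{⌊n^{1/(a+1)}⌋}` (the root typed as `Nat.findGreatest (r ↦ r^{a+1} ≤ n) n`).
THE DIAL IS NOW PINNED ON BOTH SIDES IN KERNEL: `≡ T` at every constant index (§12), THEOREM at every index `≥ n^{1/(a+1)}` (this §),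
OPEN exactly on the window `ω(1) ≤ k(n) ≤ n^{o(1)}` — `W′ = N_{log n+1}` and every `N_{polylog}` inside it. -/

section Padded

variable {n₁ n₂ k₁ k₂ : ℕ} {m : ℕ}

/-- ★ COUPLED SUMS MULTIPLY over direct sums `(F₁ ⊞ F₂, G₁ ⊞ G₂, L₁ ⊕ L₂)`. -/
theorem csum_dsum (F₁ G₁ : CubicForm n₁) (F₂ G₂ : CubicForm n₂) (L₁ : Fin n₁ → Fin n₁ → Bool) (L₂ : Fin n₂ → Fin n₂ → Bool) :
    ∑ x : Fin (n₁ + n₂) → Bool, ∑ y : Fin (n₁ + n₂) → Bool,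
        signOf ((dsum F₁ F₂).eval x) * twist x (mv (blockDiag L₁ L₂) y) * signOf ((dsum G₁ G₂).eval y)
      = (∑ x₁ : Fin n₁ → Bool, ∑ y₁ : Fin n₁ → Bool, signOf (F₁.eval x₁) * twist x₁ (mv L₁ y₁) * signOf (G₁.eval y₁)) *
        (∑ x₂ : Fin n₂ → Bool, ∑ y₂ : Fin n₂ → Bool, signOf (F₂.eval x₂) * twist x₂ (mv L₂ y₂) * signOf (G₂.eval y₂)) := by
  have hy : ∀ (x₁ : Fin n₁ → Bool) (x₂ : Fin n₂ → Bool),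
      ∑ y : Fin (n₁ + n₂) → Bool, signOf ((dsum F₁ F₂).eval (Fin.append x₁ x₂)) *
          twist (Fin.append x₁ x₂) (mv (blockDiag L₁ L₂) y) * signOf ((dsum G₁ G₂).eval y)
        = (∑ y₁ : Fin n₁ → Bool, signOf (F₁.eval x₁) * twist x₁ (mv L₁ y₁) * signOf (G₁.eval y₁)) *
          (∑ y₂ : Fin n₂ → Bool, signOf (F₂.eval x₂) * twist x₂ (mv L₂ y₂) * signOf (G₂.eval y₂)) := by
    intro x₁ x₂
    rw [sum_append, sum_mul_sum]
    refine sum_congr rfl fun y₁ _ => sum_congr rfl fun y₂ _ => ?_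
    rw [mv_blockDiag, twist_append, eval_dsum, eval_dsum, signOf_xor, signOf_xor]
    ring
  rw [sum_append]
  simp_rw [hy]
  rw [sum_mul_sum]

/-- ★ COUPLED VALUES MULTIPLY: `Φ_{L₁ ⊕ L₂}(F₁ ⊞ F₂, G₁ ⊞ G₂) = Φ_{L₁}(F₁,G₁) · Φ_{L₂}(F₂,G₂)`. -/
theorem cvalue_dsum (F₁ G₁ : CubicForm n₁) (F₂ G₂ : CubicForm n₂) (L₁ : Fin n₁ → Fin n₁ → Bool) (L₂ : Fin n₂ → Fin n₂ → Bool) :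
    (⟨n₁ + n₂, dsum F₁ F₂, dsum G₁ G₂, blockDiag L₁ L₂⟩ : CTriple).cvalue
      = (⟨n₁, F₁, G₁, L₁⟩ : CTriple).cvalue * (⟨n₂, F₂, G₂, L₂⟩ : CTriple).cvalue := by
  show (Real.sqrt (2 ^ (3 * (n₁ + n₂))))⁻¹ * _ = ((Real.sqrt (2 ^ (3 * n₁)))⁻¹ * _) * ((Real.sqrt (2 ^ (3 * n₂)))⁻¹ * _)
  rw [csum_dsum, sqrt_two_pow_three_mul_add, mul_inv]
  ring

/-- the FREE EXACT PADDING BLOCK `(IP_t, IP_t, 𝟙_{2t})`: identity coupling, value `Φ(IP_t, IP_t) = 1`, index `1`. -/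
def idT (t : ℕ) : CTriple := ⟨t + t, ipT t, ipT t, dM⟩

/-- CouplingDialPadded helper `cvalue_idT` (decomp-qadv land package; see the module docstring). -/
theorem cvalue_idT (t : ℕ) : (idT t).cvalue = 1 := by
  show (Real.sqrt (2 ^ (3 * (t + t))))⁻¹ *
    ∑ x : Fin (t + t) → Bool, ∑ y : Fin (t + t) → Bool, signOf ((ipT t).eval x) * twist x (mv dM y) * signOf ((ipT t).eval y) = 1
  simp_rw [mv_dM]
  rw [ipSum, inv_mul_cancel₀]
  positivity

/-- ★ THE PADDED HIDDEN-COUPLING INSTANCE `pinst w t = hinst w ⊞ idT t`: arity `(6m+6) + 2t`, coupling `(Q_w ⊕ Q_wᵀ) ⊕ 𝟙_{2t}`. -/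
def pinst (w : Fin m → Bool) (t : ℕ) : CTriple :=
  ⟨(kk m + kk m) + (t + t), dsum (Fw w) (ipT t), dsum (Gsw w) (ipT t), blockDiag (blockDiag (QQ w) (trM (QQ w))) dM⟩

/-- ★★ EXACTNESS + LABEL survive the padding: `Φ(pinst w t) = Φ(hinst w) · Φ(idT t) = -(-1)^{s_w(b₀)}`. -/
theorem cvalue_pinst (w : Fin m → Bool) (t : ℕ) : (pinst w t).cvalue = - signOf (qv w zeroVec b₀) := by
  rw [pinst, cvalue_dsum]
  show (hinst w).cvalue * (idT t).cvalue = _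
  rw [cvalue_hinst, cvalue_idT, mul_one]

/-- CouplingDialPadded helper `unipotent_dM_succ` (decomp-qadv land package; see the module docstring). -/
theorem unipotent_dM_succ {k : ℕ} (j : ℕ) : Unipotent (dM : Fin k → Fin k → Bool) (j + 1) :=
  ((unipotent_one_iff dM).mpr rfl).mono (Nat.le_add_left 1 j)

/-- unipotency index is stable under direct sums. -/
theorem unipotent_blockDiag {A : Fin k₁ → Fin k₁ → Bool} {B : Fin k₂ → Fin k₂ → Bool} {j : ℕ}
    (hA : Unipotent A j) (hB : Unipotent B j) : Unipotent (blockDiag A B) j := by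
  intro y
  obtain ⟨⟨y₁, y₂⟩, rfl⟩ := (Fin.appendEquiv _ _).surjective y
  show uiter (blockDiag A B) j (Fin.append y₁ y₂) = zeroVec
  rw [uiter_blockDiag, show uiter A j y₁ = zeroVec from hA y₁, show uiter B j y₂ = zeroVec from hB y₂]
  funext i
  refine Fin.addCases (fun a => ?_) (fun b => ?_) i
  · rw [Fin.append_left]; rfl
  · rw [Fin.append_right]; rfl

/-- ★ the padded coupling is unipotent of index `m + 1` — independent of the padding. -/
theorem unipotent_pinst (w : Fin m → Bool) (t : ℕ) : Unipotent (pinst w t).L (m + 1) :=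
  unipotent_blockDiag (unipotent_hinst w) (unipotent_dM_succ m)

/-- CouplingDialPadded helper `isLit_dsum_Gsw_cube` (decomp-qadv land package; see the module docstring). -/
theorem isLit_dsum_Gsw_cube (t : ℕ) (i j l : Fin ((kk m + kk m) + (t + t))) :
    IsLit fun w : Fin m → Bool => (dsum (Gsw w) (ipT t)).cube i j l :=
  isLit_cube3 (c₁ := fun w => (Gsw w).cube) isLit_Gsw_cube (ipT t).cube _ _ _

/-- CouplingDialPadded helper `isLit_L_pinst` (decomp-qadv land package; see the module docstring). -/
theorem isLit_L_pinst (t : ℕ) (a b : Fin ((kk m + kk m) + (t + t))) :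
    IsLit fun w : Fin m → Bool =>
      blockDiag (blockDiag (QQ w) (trM (QQ w))) (dM : Fin (t + t) → Fin (t + t) → Bool) a b := by
  refine Fin.addCases (fun a₁ => ?_) (fun a₂ => ?_) a
  · simp_rw [blockDiag_left]
    refine Fin.addCases (fun b₁ => ?_) (fun b₂ => ?_) b
    · simp_rw [Fin.append_left]; exact isLit_L_hinst _ _
    · simp_rw [Fin.append_right]; exact IsLit.const _
  · simp_rw [blockDiag_right]
    refine Fin.addCases (fun b₁ => ?_) (fun b₂ => ?_) b
    · simp_rw [Fin.append_left]; exact IsLit.const _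
    · simp_rw [Fin.append_right]; exact IsLit.const _

/-- ★ `w ↦ code(pinst w t)` IS A LITERAL PROJECTION (padding block constant, the rest as for `hinst`). -/
theorem isProj_encode_pinst (t : ℕ) : IsProj fun w : Fin m → Bool => (pinst w t).encode := by
  show IsProj fun w : Fin m → Bool =>
    boolPair (CTriple.matBits (blockDiag (blockDiag (QQ w) (trM (QQ w))) (dM : Fin (t + t) → Fin (t + t) → Bool)))
      (boolPair (encodeNat ((kk m + kk m) + (t + t))) (boolPair (dsum (Fw w) (ipT t)).encode (dsum (Gsw w) (ipT t)).encode))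
  refine (IsProj.ofFn _ fun q => IsProj.single (isLit_L_pinst t _ _)).boolPair ((IsProj.const _).boolPair
    ((isProj_encode_form (fun w => dsum (Fw w) (ipT t)) false (fun _ => rfl) (isLit_dsum_Fw_cube t)).boolPair
      (isProj_encode_form (fun w => dsum (Gsw w) (ipT t)) true (fun _ => rfl) (isLit_dsum_Gsw_cube t))))

/-- CouplingDialPadded helper `pinst_n_le` (decomp-qadv land package; see the module docstring). -/
theorem pinst_n_le (w : Fin m → Bool) {t : ℕ} {B : Polynomial ℕ} (ht : t ≤ B.eval m) : (pinst w t).n ≤ (nPoly B).eval m :=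
  cinst_n_le w ht

/-- CouplingDialPadded helper `length_encode_pinst_le` (decomp-qadv land package; see the module docstring). -/
theorem length_encode_pinst_le (w : Fin m → Bool) {t : ℕ} {B : Polynomial ℕ} (ht : t ≤ B.eval m) :
    (pinst w t).encode.length ≤ (tPoly.comp (nPoly B)).eval m := by
  rw [Polynomial.eval_comp]
  exact (length_encode_le_tPoly _).trans (natPoly_eval_mono tPoly (pinst_n_le w ht))

/-- CouplingDialPadded helper `even_pinst_n` (decomp-qadv land package; see the module docstring). -/
theorem even_pinst_n (w : Fin m → Bool) (t : ℕ) : Even (pinst w t).n := even_cinst_n w t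

/-- CouplingDialPadded helper `pinst_mem_nil_yes` (decomp-qadv land package; see the module docstring). -/
theorem pinst_mem_nil_yes (w : Fin m → Bool) {t : ℕ} {k' : ℕ → ℕ} (hk : m + 1 ≤ k' ((kk m + kk m) + (t + t)))
    (h3 : GateFn.numOnes w % 3 = 0) : (pinst w t).encode ∈ (NilSlice k').yes := by
  refine ⟨pinst w t, ⟨even_pinst_n w t, (unipotent_pinst w t).mono hk, ?_⟩, rfl⟩
  rw [cvalue_pinst, qv_zeroVec_b₀, decide_eq_true h3]; norm_num [signOf]

/-- CouplingDialPadded helper `pinst_mem_nil_no` (decomp-qadv land package; see the module docstring). -/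
theorem pinst_mem_nil_no (w : Fin m → Bool) {t : ℕ} {k' : ℕ → ℕ} (hk : m + 1 ≤ k' ((kk m + kk m) + (t + t)))
    (h3 : ¬ GateFn.numOnes w % 3 = 0) : (pinst w t).encode ∈ (NilSlice k').no := by
  refine ⟨pinst w t, ⟨even_pinst_n w t, (unipotent_pinst w t).mono hk, ?_⟩, rfl⟩
  rw [cvalue_pinst, qv_zeroVec_b₀, decide_eq_false h3]; norm_num [signOf]

/-- ★★★ THE PADDED SCHEDULE THEOREM on the unipotency dial: a polynomially bounded padding `t(m)` with
`m + 1 ≤ k((6m+6) + 2t(m))` for all `m` gives `N_k`.  [PROVED: label `MOD₃`, code a projection of `w`, Smolensky.] -/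
theorem nilRung_of_schedule (k' : ℕ → ℕ) (t : ℕ → ℕ) (B : Polynomial ℕ) (ht : ∀ m, t m ≤ B.eval m)
    (hk : ∀ m, m + 1 ≤ k' ((kk m + kk m) + (t m + t m))) : NilRung k' :=
  not_promiseLift_AC0Mod_of_proj Nat.prime_two Nat.prime_three (by decide) _ (fun m w => (pinst w (t m)).encode)
    (fun m => isProj_encode_pinst (t m)) (tPoly.comp (nPoly B)) (fun m w => length_encode_pinst_le w (ht m))
    (fun m w h => pinst_mem_nil_yes w (hk m) h) (fun m w h => pinst_mem_nil_no w (hk m) h)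

/-- ★★ `N_{√n}` IS A THEOREM (padding `t = (m+1)²`: arity `n = 6(m+1) + 2(m+1)² ≥ (m+1)²`). -/
theorem nilRung_sqrt : NilRung Nat.sqrt :=
  nilRung_of_schedule _ (fun m => (m + 1) ^ 2) ((Polynomial.X + 1) ^ 2) (fun m => by simp) fun m =>
    Nat.le_sqrt.mpr (by simp only [kk]; nlinarith)

/-- ★★★ EVERY POLYNOMIAL ROOT: `N_{⌊n^{1/(a+1)}⌋}` IS A THEOREM (padding `t = (m+1)^{a+1}`), the integer root typed as
`Nat.findGreatest (fun r => r ^ (a+1) ≤ n) n`. -/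
theorem nilRung_root (a : ℕ) : NilRung fun n => Nat.findGreatest (fun r => r ^ (a + 1) ≤ n) n :=
  nilRung_of_schedule _ (fun m => (m + 1) ^ (a + 1)) ((Polynomial.X + 1) ^ (a + 1)) (fun m => by simp) fun m =>
    Nat.le_findGreatest (by simp only [kk]; omega) (by simp only [kk]; omega)

/-- schedules dominating a polynomial root inherit the theorem (`nilRung_mono`). -/
theorem nilRung_of_root_le (a : ℕ) {k' : ℕ → ℕ} (hk : ∀ n, Nat.findGreatest (fun r => r ^ (a + 1) ≤ n) n ≤ k' n) : NilRung k' :=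
  nilRung_mono hk (nilRung_root a)

/-- the ladder after rev 5: `T ⟺ N_{c+1}` (every constant `c`) `⟹ W′ = N_{log n+1}` (OPEN); `N_{⌊n^{1/(a+1)}⌋}` THEOREM for every `a`
(and `N_{√n}`, `N_{n/6}`): the open window of the unipotency dial is exactly `ω(1) ≤ k(n) ≤ n^{o(1)}`. -/
theorem dial_summary_rev5 :
    (∀ c, RungANonuniform ↔ ConstNilRung c) ∧ (RungANonuniform → LogNilRung) ∧
      (∀ a, NilRung fun n => Nat.findGreatest (fun r => r ^ (a + 1) ≤ n) n) ∧ NilRung Nat.sqrt ∧ NilRung (fun n => n / 6) :=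
  ⟨fun c => (constNilRung_iff c).symm, logNilRung_of_rungANonuniform, nilRung_root, nilRung_sqrt, nilRung_sixth⟩

end Padded

end Summit.QuantumAdvantage.QuantumAdvantage.Theorems.CouplingDial

end
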